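import Summits.QuantumFields.BalabanUV.T4Continuum.Support.DirichletTubeEnergy
import Summits.QuantumFields.BalabanUV.T4Continuum.Support.DirichletVertexCover

/-!
# `BalabanUV.T4Continuum.Support.DirichletTubeMass` — NE2 (node U1a) formalisation swarm, sub-row `T4-U1a.S-NE2-D1-DIRICHLET°`, supplier item
# «Δ1-TUBES» (file T3): THE MASS NEAR AN EDGE DECAYS, ONE TUBE — slice by slice, file 15's octant Poincaré on the transversal torus (the slice of
# a field supported in `blockReg S` is supported in the sliced block region, file T1, and vanishes on the exterior transversal octant) turns
# the mass within `r` of the edge on the plateau into the small-cube transversal Dirichlet forms, which file T2 makes decay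
# (unit b2b-balaban-t4-ne2-formalise-leaf-08, gen 7, file T3)

HONEST FRAMING.  Rung (B)+1 estimate at MODEL level (one lattice field, finite torus); [folklore]; NE2 (U1a) is NOT proved by this file; spine
PROVED 0/9 unchanged; NOT infinite volume, NOT the mass gap, NOT Clay.  HONEST DEPENDENCY (verbatim): «continuum YM on T⁴ ⇐ BetaPertH ∧ nine
spine estimates (0/9 proved); BetaPertH ⇐ (D1) ∧ (D4) ∧ CAP+tail; G-an2-4 gates asym, D1 and NE2/3/4.»

WHAT THIS FILE PROVES (0 sorry; files T1, T2, 15 BY NAME).  `plateau_subset_zone` and the END **`near_edge_mass_le`**: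
`Σ_{t∈plateau} Σ_{y : NearVtx r β′ y} ‖z(ins t y)‖² ≤ (1+2^d)(n₀(n₀+1)/2)/n² · θ_d^J · (zone budget of file T2)`.

ABSOLUTE RULE (cell, verbatim): «No internally-minted statement may enter as a cited fact. Every hypothesis is either kernel-proved in
this package or a verbatim quotation of a PUBLISHED theorem with page reference. The manuscript(s) under audit are NOT citable for
their own disputed steps — they are the thing under adjudication; programme-internal (2001/route/tribunal) claims are never citable.»
[folklore]; no definition; no `def … : Prop` fact.  NOT CLAIMED: the sum over tubes, the cover, NE2, NE3.
-/

noncomputable section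

open scoped BigOperators ComplexConjugate Matrix
open Finset

namespace Summit.QuantumFields.BalabanUV.T4Continuum.DirichletTubeMass

open Literature.MathematicalPhysics.QuantumFieldTheory.Balaban1983to89.B5Prop11Plancherel (Tor fine)
open Literature.MathematicalPhysics.QuantumFieldTheory.Balaban1983to89.B5Action121 (LapS)
open Summit.QuantumFields.BalabanUV.Beta.GAN24.DirichletBoxTrace (blockReg)
open Summit.QuantumFields.BalabanUV.T4Continuum.DirichletDirectionalBesov (restrictTo)
open Summit.QuantumFields.BalabanUV.T4Continuum.CoordSlabPoincare (dirOn dirOn_nonneg)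
open Summit.QuantumFields.BalabanUV.T4Continuum.DirichletHoleFillingCutoff (chart)
open Summit.QuantumFields.BalabanUV.T4Continuum.DirichletHoleFilling (theta theta_lt_one)
open Summit.QuantumFields.BalabanUV.T4Continuum.DirichletMorreyDecayBlock (cornerBase cornerBlock)
open Summit.QuantumFields.BalabanUV.T4Continuum.DirichletVertexCubes (NearVtx vtxBase)
open Summit.QuantumFields.BalabanUV.T4Continuum.DirichletVertexCover (sum_nearVtx_normSq_le_dirOn)
open Summit.QuantumFields.BalabanUV.T4Continuum.TorusSlicing (ins zsl)
open Summit.QuantumFields.BalabanUV.T4Continuum.LongitudinalRamp (lchart phiL zoneL)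
open Summit.QuantumFields.BalabanUV.T4Continuum.DirichletTubeBlock (Msl blk1 Ssl zsl_support)
open Summit.QuantumFields.BalabanUV.T4Continuum.DirichletTubeEnergy (plateau sum_plateau_le_sum_weight tube_decay_energy)

variable {d : ℕ} {n : ℕ} [NeZero n] {M : Fin (d + 1) → ℕ} [hM : ∀ μ, NeZero (M μ)] {lam : Fin (d + 1)}

omit hM [NeZero n] in
/-- the plateau lies in the zone. [folklore] -/
theorem plateau_subset_zone (kL : ℕ) {nL : ℕ} (t₀ : ZMod (fine n M lam)) :
    plateau n M lam kL (nL := nL) t₀ ⊆ zoneL (fine n M) lam (nL := nL) t₀ := by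
  intro t ht
  rw [plateau, mem_image] at ht
  obtain ⟨s, -, rfl⟩ := ht
  rw [zoneL, mem_image]
  exact ⟨s, mem_univ _, rfl⟩

section Mass

variable {kL nL : ℕ} (hkL : 2 ≤ kL) (hnL : 4 * kL = nL + 1) (hfit : nL + 1 ≤ fine n M lam) (t₀ : ZMod (fine n M lam))
  (hd : 2 ≤ d) (S : Tor M → Prop) [DecidablePred S] {z : Tor (fine n M) → ℂ} (hz : ∀ x, ¬ blockReg n M S x → z x = 0)
  (β' : Tor (Msl M lam)) (σ : Fin d → Bool)
  (hext : ∀ t ∈ zoneL (fine n M) lam (nL := nL) t₀, ¬ S (Fin.insertNth lam (blk1 n M lam t) (cornerBlock (Msl M lam) β' σ)))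
  {m : ℕ} (h4m : 4 * m ≤ n) {n₀ : ℕ} (hn₀ : 4 * m = n₀ + 1) {r : ℕ} (hr : r ≤ 2 * m)
  (J : ℕ) {nn : ℕ} (hnn : 4 * (2 ^ J * m) = nn + 1) (hK : 2 * (2 ^ J * m) ≤ n) (hN' : ∀ ν, nn + 1 ≤ fine n (Msl M lam) ν)
include hkL hnL hfit hd hz hext h4m hn₀ hr hnn hK hN'

/-- **THE MASS NEAR AN EDGE DECAYS (one tube).** [folklore] -/
theorem near_edge_mass_le [DecidablePred (NearVtx n (Msl M lam) r β')] :
    ∑ t ∈ plateau n M lam kL (nL := nL) t₀, ∑ y : Tor (fine n (Msl M lam)),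
        (if NearVtx n (Msl M lam) r β' y then ‖z (ins (fine n M) lam t y)‖ ^ 2 else 0)
      ≤ (1 + 2 ^ d) * ((n₀ : ℝ) * (n₀ + 1) / 2) / (n : ℝ) ^ 2 * (theta d ^ J
          * ((1 + (64 * (1 + 2 ^ d) * (((2 ^ J * m : ℕ) : ℝ)) ^ 2) * (4 * (1 / ((kL : ℝ) - 1)) ^ 2))
            * ∑ t ∈ zoneL (fine n M) lam (nL := nL) t₀, (n : ℝ) ^ 2 * dirOn (univ : Finset (Fin d → Fin (nn + 1)))
                (zsl (fine n M) lam z t ∘ chart (fine n (Msl M lam)) (n := nn) (cornerBase n (Msl M lam) β' (2 ^ J * m)))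
          + 64 * (1 + 2 ^ d) * (((2 ^ J * m : ℕ) : ℝ)) ^ 2 / (n : ℝ) ^ 2
            * ∑ t ∈ zoneL (fine n M) lam (nL := nL) t₀, ∑ j : Fin d → Fin (nn + 1),
                ‖restrictTo (blockReg n M S) (LapS (fine n M) (n : ℂ) *ᵥ z) (ins (fine n M) lam t (chart (fine n (Msl M lam)) (cornerBase n (Msl M lam) β' (2 ^ J * m)) j))‖ ^ 2)) := by
  have hm : 1 ≤ m := by omega
  have hmK : m ≤ 2 ^ J * m := Nat.le_mul_of_pos_left m (pow_pos (by norm_num) J)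
  have hnpos : (0 : ℝ) < n := by exact_mod_cast Nat.pos_of_ne_zero (NeZero.ne n)
  set cP : ℝ := (1 + 2 ^ d) * ((n₀ : ℝ) * (n₀ + 1) / 2) with hcP
  have hcP0 : 0 ≤ cP := by rw [hcP]; positivity
  -- slice by slice: file 15 on the transversal torus with the sliced block set
  have hslice : ∀ t ∈ plateau n M lam kL (nL := nL) t₀, ∑ y : Tor (fine n (Msl M lam)),
        (if NearVtx n (Msl M lam) r β' y then ‖z (ins (fine n M) lam t y)‖ ^ 2 else 0)
      ≤ cP * dirOn (univ : Finset (Fin d → Fin (n₀ + 1)))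
          (zsl (fine n M) lam z t ∘ chart (fine n (Msl M lam)) (n := n₀) (vtxBase n (Msl M lam) m (2 ^ J * m) β')) := by
    intro t ht
    exact sum_nearVtx_normSq_le_dirOn hmK h4m hn₀ hr (Ssl M lam S (blk1 n M lam t)) (zsl_support n M lam S hz t) β' σ
      (hext t (plateau_subset_zone kL t₀ ht))
  refine (Finset.sum_le_sum hslice).trans ?_
  -- `Σ_{plateau} cP·dirOn = cP/n²·Σ_{plateau} n²·dirOn ≤ cP/n²·Σ_t φ²·(n²·dirOn) ≤ cP/n²·(tube decay)`
  have hpl := sum_plateau_le_sum_weight (n := n) (M := M) (lam := lam) hkL hfit t₀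
    (X := fun t => (n : ℝ) ^ 2 * dirOn (univ : Finset (Fin d → Fin (n₀ + 1)))
      (zsl (fine n M) lam z t ∘ chart (fine n (Msl M lam)) (n := n₀) (vtxBase n (Msl M lam) m (2 ^ J * m) β')))
    (fun t => mul_nonneg (sq_nonneg _) (dirOn_nonneg _ _))
  have htube := tube_decay_energy hkL hnL hfit t₀ hd S hz β' σ hext hm hn₀ J hnn hK hN'
  have e : ∑ t ∈ plateau n M lam kL (nL := nL) t₀, cP * dirOn (univ : Finset (Fin d → Fin (n₀ + 1)))
        (zsl (fine n M) lam z t ∘ chart (fine n (Msl M lam)) (n := n₀) (vtxBase n (Msl M lam) m (2 ^ J * m) β'))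
      = cP / (n : ℝ) ^ 2 * ∑ t ∈ plateau n M lam kL (nL := nL) t₀, (n : ℝ) ^ 2 * dirOn (univ : Finset (Fin d → Fin (n₀ + 1)))
        (zsl (fine n M) lam z t ∘ chart (fine n (Msl M lam)) (n := n₀) (vtxBase n (Msl M lam) m (2 ^ J * m) β')) := by
    rw [Finset.mul_sum]
    refine Finset.sum_congr rfl fun t _ => ?_
    field_simp
  rw [e]
  exact mul_le_mul_of_nonneg_left (hpl.trans htube) (by positivity)

end Mass

end Summit.QuantumFields.BalabanUV.T4Continuum.DirichletTubeMass

end
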